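import Summits.QuantumFields.YangMills.Theorems.SwapVirialDeficitBlowUpGnomonicCommutatorFloor
import Summits.QuantumFields.YangMills.Theorems.SwapVirialDeficitQuantitativeLaplaceRayMinorant
import HarnessLib

/-!
# THE ANISOTROPIC FIBRE COERCIVITY at the gnomonic base points: `Q_{a,ε,(x₀,y₀)}(w) ≥ Q_low(w)` with EXPLICIT hub-dependent soft coefficients
# (free-hands support of ⟨stmt-QuantumFields-24197⟩ `SwapVirialDeficit.SwapGluedStiffness`; the quadratic-form floor behind stub S3∕S4 «finiteness and tails of the
# bottom measure» of fcl-p3 g47's sector skeleton — principal sector)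

w3 g65's ✓`fibre_raySecond_coercive_gnomonic[_flat]` is ISOTROPIC: `μ′·N(w) ≤ Q(w)` with the single constant `μ′ = min κ`, which makes the Gaussian bound
`∫e^{−Q/2} ≤ (2π/μ′)^α` blow up like `sin^{−18L⁴}ψ` at the tip — not integrable against the cone law.  Here the three GLOBAL smooth minorants of the deficit in
gnomonic letters, each of the form `s²·h(s)` along a fibre ray and each touching `F̂` at the (exactly flat, ✓`gnoDeficit_base_eq_zero`) base point,
* hub weight ✓`leadersW_hubStiff_le`: `[(2A₀A₁)²·gnoWtr(η_x) + A₁²·gnoWtr(η_y) + gnomonicW(η_z)]/16200L⁶ ≤ F̂` (`A₀ = re a/‖a‖`, `A₁ = ‖im a‖/‖a‖`),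
* follower Frobenius floor ✓`sum_follower_frobNorm_sq_le_chartDeficit` + ✓`gnoFollower_frobNorm_sq_bounds`: `Σ_f 2|η_f|²/((1+|η_f|²)·2304L⁶|Fol L|) ≤ F̂`,
* commutator floor ✓`gnoDeficit_one_ge_relRot`: `|y₀u − x₀v|²/(450L⁶(1+x₀²+|u|²)(1+y₀²+|v|²)) ≤ F̂`,
are passed to second derivatives by ✓`iteratedDeriv_two_ge_of_three_minorants` ∕ ✓`iteratedDeriv_two_sq_mul`:
* §1 ray closed forms: `gnoWtr_axial_ray` (`gnoWtr((c,0,0) + s·(0,u)) = s²·4|u|²/(1 + c² + s²|u|²)`), `gnomonicW_smul_ray`, `gnoFollower_floor_smul`, `fibrePoint_ray_letters`;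
* §2 the three touching ray minorants `hub_ray_minorant`, `follower_ray_minorant`, `relRot_ray_minorant` (each `∀ s, s²h(s) ≤ F̂(η₀ + s·ξ(w))`), with `h` smooth;
* §3 ★★★ `fibre_raySecond_ge_aniso (ha : a ≠ 0) (ε) (hz : ε.2.1 = true) (hε : ε.2.2 = fun _ => true) (x₀ y₀ w)`:
  `Q(w) ≥ (2/3)·[ ((2A₀A₁)²·4|u|²/(1+x₀²) + A₁²·4|v|²/(1+y₀²) + 4|z|²)/16200L⁶ + 2Σ_f|η_f|²/(2304L⁶|Fol L|) + |y₀u − x₀v|²/(450L⁶(1+x₀²)(1+y₀²)) ]`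
  — the 4 soft directions `u, v` carry `sin²2ψ/(1+x₀²)`, `sin²ψ/(1+y₀²)` AND the hub-independent relative-rotation form `|y₀u − x₀v|²`; `z` and the followers are hard
  (`poly(L)⁻¹`).  Per transverse component the soft `2×2` block has determinant `≍ ab + c(a x₀² + b y₀²)` (`a ∝ sin²2ψ`, `b ∝ sin²ψ`, `c ∝ 1`), i.e. `≍ ψ²(ψ² + x₀² + y₀²)`
  near the tip: this is what makes the Morse–Bott density `ρ(η₀)/√det` integrable against `ψ²dψ dx₀dy₀` there (LEAD g97 «codimension = radial exponent»).
What is NOT here: the Gaussian-integral∕determinant step (`∫e^{−Q/2} ≤ (2π)^α/√det Q_low`), the `[C₀,C₁]` floor `x₀²sin²ψ|u|²` needed at the END `ψ → π/2`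
(stratum B of LEAD memo4 §2), and the cone × ℝ² integral itself.

HONEST LABEL: composition of landed inequalities; S3∕S4∕S5, ⟨24197⟩ (window-uniform) ∕ ⟨24194⟩ ∕ ⟨24497⟩ OPEN; own crux ⟨22884⟩ OPEN (blocked-on ⟨19935⟩); no crux,
rung of record or summit is proved; the Yang–Mills mass gap is NOT proved; no summit is proved by a line.  THEOREMS ONLY (0 `def`, 0 `sorry`), standard axioms.
Width seat ym-line-sfw-p2-w3 g66 (cell ym-idea-1, free hands), `--supports stmt-QuantumFields-24197`.  References: [cite: Luscher1983, §2]; [folklore].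
-/

set_option autoImplicit false

noncomputable section

open MeasureTheory Quaternion
open scoped BigOperators Quaternion ContDiff
open Literature.MathematicalPhysics.QuantumFieldTheory hiding SU2
open Literature.MathematicalPhysics.QuantumLattice

namespace Summit.QuantumFields.YangMills.Theorems.SwapVirialDeficit.BlowUpRing

open Summit.QuantumFields.YangMills.Theorems.FemtoTransferGap
open Summit.QuantumFields.YangMills.Theorems.FemtoTransferGap.TT
open Summit.QuantumFields.YangMills.Theorems.VirialFluxGap.RingDeficit
open Summit.QuantumFields.YangMills.Theorems.SwapVirialDeficit.SwapRing
open Summit.QuantumFields.YangMills.Theorems.SwapVirialDeficit.Gnomonic (normSq3 normSq3_nonneg normSq3_smul gnomonicW gnomonicW_nonneg_le contDiff_gnoDeficit)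
open Summit.QuantumFields.YangMills.Theorems.QuantitativeLaplace (iteratedDeriv_two_ge_of_three_minorants iteratedDeriv_two_sq_mul contDiff_sq_mul)

variable {L : ℕ} [NeZero L]

/-! ## §1 Ray closed forms of the letters' weights -/

omit [NeZero L] in
/-- The transverse weight along an axial ray: `gnoWtr((c,0,0) + s·(0,u₀,u₁)) = s²·(4(u₀²+u₁²)/(1 + c² + s²(u₀²+u₁²)))`. [folklore] -/
theorem gnoWtr_axial_ray (c u₀ u₁ s : ℝ) :
    gnoWtr ((![c, 0, 0] : Fin 3 → ℝ) + s • ![0, u₀, u₁]) = s ^ 2 * (4 * (u₀ ^ 2 + u₁ ^ 2) / (1 + c ^ 2 + s ^ 2 * (u₀ ^ 2 + u₁ ^ 2))) := by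
  simp only [gnoWtr, Fin.sum_univ_three, Pi.add_apply, Pi.smul_apply, smul_eq_mul, Matrix.cons_val_zero, Matrix.cons_val_one, Matrix.cons_val_two,
    Matrix.head_cons, Matrix.tail_cons, mul_zero, add_zero, zero_add]
  have hd : 0 < 1 + (c ^ 2 + (s * u₀) ^ 2 + (s * u₁) ^ 2) := by positivity
  have hd' : 0 < 1 + c ^ 2 + s ^ 2 * (u₀ ^ 2 + u₁ ^ 2) := by positivity
  field_simp
  ring

omit [NeZero L] in
/-- The full weight along a ray through the origin: `gnomonicW(s·z) = s²·(4|z|²/(1 + s²|z|²))`. [folklore] -/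
theorem gnomonicW_smul_ray (s : ℝ) (z : Fin 3 → ℝ) : gnomonicW (s • z) = s ^ 2 * (4 * normSq3 z / (1 + s ^ 2 * normSq3 z)) := by
  rw [gnomonicW, normSq3_smul]
  have h := normSq3_nonneg z
  have hd : 0 < 1 + s ^ 2 * normSq3 z := by positivity
  field_simp

omit [NeZero L] in
/-- The follower Frobenius floor along a ray through the reference: `s²·(2|v|²/(1 + s²|v|²)) ≤ ‖gno⁺(s·v) − 1‖²_F`. [folklore] -/
theorem gnoFollower_floor_smul (s : ℝ) (v : Fin 3 → ℝ) :
    s ^ 2 * (2 * normSq3 v / (1 + s ^ 2 * normSq3 v)) ≤ frobNorm (((quatToSU2 (gnoLetter true (s • v)) : SU2) : Matrix (Fin 2) (Fin 2) ℂ) - 1) ^ 2 := by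
  have h := (gnoFollower_frobNorm_sq_bounds (s • v)).1
  rw [normSq3_smul] at h
  have hd : 0 < 1 + s ^ 2 * normSq3 v := by have := normSq3_nonneg v; positivity
  calc s ^ 2 * (2 * normSq3 v / (1 + s ^ 2 * normSq3 v)) = 2 * (s ^ 2 * normSq3 v) / (1 + s ^ 2 * normSq3 v) := by field_simp
    _ ≤ _ := h

omit [NeZero L] in
/-- The letters of the ray point `η₀(x₀,y₀) + s·ξ(w)`. [folklore] -/
theorem fibrePoint_ray_letters (x₀ y₀ s : ℝ) (w : ((Fin 2 → ℝ) × (Fin 2 → ℝ)) × (Fin 3 → ℝ) × (Fol L → Fin 3 → ℝ)) :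
    (((((![x₀, 0, 0] : Fin 3 → ℝ), (![y₀, 0, 0] : Fin 3 → ℝ)), ((0 : Fin 3 → ℝ), (0 : Fol L → Fin 3 → ℝ))) : GnoCoord L) +
        s • ((((![0, w.1.1 0, w.1.1 1] : Fin 3 → ℝ), (![0, w.1.2 0, w.1.2 1] : Fin 3 → ℝ)), (w.2.1, w.2.2)) : GnoCoord L)).1.1 = (![x₀, 0, 0] : Fin 3 → ℝ) + s • ![0, w.1.1 0, w.1.1 1] ∧
    (((((![x₀, 0, 0] : Fin 3 → ℝ), (![y₀, 0, 0] : Fin 3 → ℝ)), ((0 : Fin 3 → ℝ), (0 : Fol L → Fin 3 → ℝ))) : GnoCoord L) +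
        s • ((((![0, w.1.1 0, w.1.1 1] : Fin 3 → ℝ), (![0, w.1.2 0, w.1.2 1] : Fin 3 → ℝ)), (w.2.1, w.2.2)) : GnoCoord L)).1.2 = (![y₀, 0, 0] : Fin 3 → ℝ) + s • ![0, w.1.2 0, w.1.2 1] ∧
    (((((![x₀, 0, 0] : Fin 3 → ℝ), (![y₀, 0, 0] : Fin 3 → ℝ)), ((0 : Fin 3 → ℝ), (0 : Fol L → Fin 3 → ℝ))) : GnoCoord L) +
        s • ((((![0, w.1.1 0, w.1.1 1] : Fin 3 → ℝ), (![0, w.1.2 0, w.1.2 1] : Fin 3 → ℝ)), (w.2.1, w.2.2)) : GnoCoord L)).2.1 = s • w.2.1 ∧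
    (((((![x₀, 0, 0] : Fin 3 → ℝ), (![y₀, 0, 0] : Fin 3 → ℝ)), ((0 : Fin 3 → ℝ), (0 : Fol L → Fin 3 → ℝ))) : GnoCoord L) +
        s • ((((![0, w.1.1 0, w.1.1 1] : Fin 3 → ℝ), (![0, w.1.2 0, w.1.2 1] : Fin 3 → ℝ)), (w.2.1, w.2.2)) : GnoCoord L)).2.2 = s • w.2.2 := by
  refine ⟨rfl, rfl, ?_, ?_⟩
  · show (0 : Fin 3 → ℝ) + s • w.2.1 = s • w.2.1
    rw [zero_add]
  · show (0 : Fol L → Fin 3 → ℝ) + s • w.2.2 = s • w.2.2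
    rw [zero_add]

/-! ## §2 The three touching ray minorants -/

section Minorants

variable {a : ℍ} (ε : GnoSign L) (x₀ y₀ : ℝ) (w : ((Fin 2 → ℝ) × (Fin 2 → ℝ)) × (Fin 3 → ℝ) × (Fol L → Fin 3 → ℝ))

/-- ★ **HUB RAY MINORANT** (✓`leadersW_hubStiff_le` along the ray, in closed form):
`s²·[(2A₀A₁)²·4|u|²/(1+x₀²+s²|u|²) + A₁²·4|v|²/(1+y₀²+s²|v|²) + 4|z|²/(1+s²|z|²)]/16200L⁶ ≤ F̂(η₀ + s·ξ(w))`. [cite: Luscher1983, §2] -/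
theorem hub_ray_minorant (ha : a ≠ 0) (s : ℝ) :
    s ^ 2 * (((2 * (‖a‖⁻¹ * a.re) * (‖a‖⁻¹ * ‖a.im‖)) ^ 2 * (4 * (w.1.1 0 ^ 2 + w.1.1 1 ^ 2) / (1 + x₀ ^ 2 + s ^ 2 * (w.1.1 0 ^ 2 + w.1.1 1 ^ 2))) +
        (‖a‖⁻¹ * ‖a.im‖) ^ 2 * (4 * (w.1.2 0 ^ 2 + w.1.2 1 ^ 2) / (1 + y₀ ^ 2 + s ^ 2 * (w.1.2 0 ^ 2 + w.1.2 1 ^ 2))) +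
        4 * normSq3 w.2.1 / (1 + s ^ 2 * normSq3 w.2.1)) / (16200 * (L : ℝ) ^ 6)) ≤
      gnoDeficit (fun _ => false) (fun _ => 1) a ε
        (((((![x₀, 0, 0] : Fin 3 → ℝ), (![y₀, 0, 0] : Fin 3 → ℝ)), ((0 : Fin 3 → ℝ), (0 : Fol L → Fin 3 → ℝ))) : GnoCoord L) +
          s • ((((![0, w.1.1 0, w.1.1 1] : Fin 3 → ℝ), (![0, w.1.2 0, w.1.2 1] : Fin 3 → ℝ)), (w.2.1, w.2.2)) : GnoCoord L)) := by
  have hL : (0 : ℝ) < L := by exact_mod_cast NeZero.pos L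
  have h := leadersW_hubStiff_le (L := L) ha ε
    (((((![x₀, 0, 0] : Fin 3 → ℝ), (![y₀, 0, 0] : Fin 3 → ℝ)), ((0 : Fin 3 → ℝ), (0 : Fol L → Fin 3 → ℝ))) : GnoCoord L) +
      s • ((((![0, w.1.1 0, w.1.1 1] : Fin 3 → ℝ), (![0, w.1.2 0, w.1.2 1] : Fin 3 → ℝ)), (w.2.1, w.2.2)) : GnoCoord L))
  obtain ⟨e1, e2, e3, -⟩ := fibrePoint_ray_letters (L := L) x₀ y₀ s w
  rw [e1, e2, e3, gnoWtr_axial_ray, gnoWtr_axial_ray, gnomonicW_smul_ray] at h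
  unfold gnoDeficit
  have h16 : (0 : ℝ) < 16200 * (L : ℝ) ^ 6 := by positivity
  set X : ℝ := 4 * (w.1.1 0 ^ 2 + w.1.1 1 ^ 2) / (1 + x₀ ^ 2 + s ^ 2 * (w.1.1 0 ^ 2 + w.1.1 1 ^ 2)) with hX
  set Y : ℝ := 4 * (w.1.2 0 ^ 2 + w.1.2 1 ^ 2) / (1 + y₀ ^ 2 + s ^ 2 * (w.1.2 0 ^ 2 + w.1.2 1 ^ 2)) with hY
  set Z : ℝ := 4 * normSq3 w.2.1 / (1 + s ^ 2 * normSq3 w.2.1) with hZ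
  have key : s ^ 2 * (((2 * (‖a‖⁻¹ * a.re) * (‖a‖⁻¹ * ‖a.im‖)) ^ 2 * X + (‖a‖⁻¹ * ‖a.im‖) ^ 2 * Y + Z) / (16200 * (L : ℝ) ^ 6)) =
      ((2 * (‖a‖⁻¹ * a.re) * (‖a‖⁻¹ * ‖a.im‖)) ^ 2 * (s ^ 2 * X) + (‖a‖⁻¹ * ‖a.im‖) ^ 2 * (s ^ 2 * Y) + s ^ 2 * Z) / (16200 * (L : ℝ) ^ 6) := by
    ring
  rw [key, div_le_iff₀ h16]
  linarith [h]

/-- ★ **FOLLOWER RAY MINORANT** (✓`sum_follower_frobNorm_sq_le_chartDeficit` + ✓`gnoFollower_frobNorm_sq_bounds`, follower signs `+`):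
`s²·Σ_f (2|η_f|²/(1+s²|η_f|²)) / (2304L⁶|Fol L|) ≤ F̂(η₀ + s·ξ(w))`. [cite: Luscher1983, §2] -/
theorem follower_ray_minorant (a : ℍ) (hε : ε.2.2 = fun _ => true) (s : ℝ) :
    s ^ 2 * ((∑ f, 2 * normSq3 (w.2.2 f) / (1 + s ^ 2 * normSq3 (w.2.2 f))) / (2304 * (L : ℝ) ^ 6 * (Fintype.card (Fol L) : ℝ))) ≤
      gnoDeficit (fun _ => false) (fun _ => 1) a ε
        (((((![x₀, 0, 0] : Fin 3 → ℝ), (![y₀, 0, 0] : Fin 3 → ℝ)), ((0 : Fin 3 → ℝ), (0 : Fol L → Fin 3 → ℝ))) : GnoCoord L) +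
          s • ((((![0, w.1.1 0, w.1.1 1] : Fin 3 → ℝ), (![0, w.1.2 0, w.1.2 1] : Fin 3 → ℝ)), (w.2.1, w.2.2)) : GnoCoord L)) := by
  have hL : (0 : ℝ) < L := by exact_mod_cast NeZero.pos L
  have hcard : 0 < (Fintype.card (Fol L) : ℝ) := by
    have h1 : 1 ≤ L := Nat.one_le_iff_ne_zero.2 (NeZero.ne L)
    have h4 : 1 ≤ L ^ 4 := Nat.one_le_pow _ _ h1
    have h : 0 < Fintype.card (Fol L) := by rw [card_fol]; omega
    exact_mod_cast h
  set q := blowUpPoint (L := L) 1 (gnomonicPoint a ε (((((![x₀, 0, 0] : Fin 3 → ℝ), (![y₀, 0, 0] : Fin 3 → ℝ)), ((0 : Fin 3 → ℝ), (0 : Fol L → Fin 3 → ℝ))) : GnoCoord L) + s • ((((![0, w.1.1 0, w.1.1 1] : Fin 3 → ℝ), (![0, w.1.2 0, w.1.2 1] : Fin 3 → ℝ)), (w.2.1, w.2.2)) : GnoCoord L))) with hq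
  have h := sum_follower_frobNorm_sq_le_chartDeficit (L := L) q
  obtain ⟨-, -, -, e4⟩ := fibrePoint_ray_letters (L := L) x₀ y₀ s w
  have hf : ∀ f, q.2 f = quatToSU2 (gnoLetter true (s • w.2.2 f)) := by
    intro f
    rw [hq, gnoFollower_eq, hε, e4]
    rfl
  have hsum : ∑ f, s ^ 2 * (2 * normSq3 (w.2.2 f) / (1 + s ^ 2 * normSq3 (w.2.2 f))) ≤
      ∑ f : Fol L, frobNorm (((q.2 f : SU2) : Matrix (Fin 2) (Fin 2) ℂ) - 1) ^ 2 :=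
    Finset.sum_le_sum fun f _ => by rw [hf]; exact gnoFollower_floor_smul s (w.2.2 f)
  have hC : (0 : ℝ) < 2304 * (L : ℝ) ^ 6 * (Fintype.card (Fol L) : ℝ) := by positivity
  have key : s ^ 2 * ((∑ f, 2 * normSq3 (w.2.2 f) / (1 + s ^ 2 * normSq3 (w.2.2 f))) / (2304 * (L : ℝ) ^ 6 * (Fintype.card (Fol L) : ℝ))) =
      (∑ f, s ^ 2 * (2 * normSq3 (w.2.2 f) / (1 + s ^ 2 * normSq3 (w.2.2 f)))) / (2304 * (L : ℝ) ^ 6 * (Fintype.card (Fol L) : ℝ)) := by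
    rw [← Finset.mul_sum]; ring
  rw [key, div_le_iff₀ hC]
  unfold gnoDeficit
  rw [← hq]
  have h' := hsum.trans h
  linarith

/-- ★ **COMMUTATOR RAY MINORANT** (✓`gnoDeficit_one_ge_relRot` along the ray): `s²·|y₀u − x₀v|²/(450L⁶(1+x₀²+s²|u|²)(1+y₀²+s²|v|²)) ≤ F̂(η₀ + s·ξ(w))`.
[cite: Luscher1983, §2] -/
theorem relRot_ray_minorant (a : ℍ) (s : ℝ) :
    s ^ 2 * (((y₀ * w.1.1 0 - x₀ * w.1.2 0) ^ 2 + (y₀ * w.1.1 1 - x₀ * w.1.2 1) ^ 2) /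
        (450 * (L : ℝ) ^ 6 * ((1 + x₀ ^ 2 + s ^ 2 * (w.1.1 0 ^ 2 + w.1.1 1 ^ 2)) * (1 + y₀ ^ 2 + s ^ 2 * (w.1.2 0 ^ 2 + w.1.2 1 ^ 2))))) ≤
      gnoDeficit (fun _ => false) (fun _ => 1) a ε
        (((((![x₀, 0, 0] : Fin 3 → ℝ), (![y₀, 0, 0] : Fin 3 → ℝ)), ((0 : Fin 3 → ℝ), (0 : Fol L → Fin 3 → ℝ))) : GnoCoord L) +
          s • ((((![0, w.1.1 0, w.1.1 1] : Fin 3 → ℝ), (![0, w.1.2 0, w.1.2 1] : Fin 3 → ℝ)), (w.2.1, w.2.2)) : GnoCoord L)) := by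
  have hL : (0 : ℝ) < L := by exact_mod_cast NeZero.pos L
  have h := gnoDeficit_one_ge_relRot (L := L) a ε x₀ y₀ (s • w)
  rw [fibreDir_smul] at h
  simp only [Prod.smul_fst, Prod.smul_snd, Pi.smul_apply, smul_eq_mul] at h
  have hD : 0 < 450 * (L : ℝ) ^ 6 * ((1 + x₀ ^ 2 + s ^ 2 * (w.1.1 0 ^ 2 + w.1.1 1 ^ 2)) * (1 + y₀ ^ 2 + s ^ 2 * (w.1.2 0 ^ 2 + w.1.2 1 ^ 2))) := by
    positivity
  have e : s ^ 2 * (((y₀ * w.1.1 0 - x₀ * w.1.2 0) ^ 2 + (y₀ * w.1.1 1 - x₀ * w.1.2 1) ^ 2) /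
        (450 * (L : ℝ) ^ 6 * ((1 + x₀ ^ 2 + s ^ 2 * (w.1.1 0 ^ 2 + w.1.1 1 ^ 2)) * (1 + y₀ ^ 2 + s ^ 2 * (w.1.2 0 ^ 2 + w.1.2 1 ^ 2))))) =
      ((y₀ * (s * w.1.1 0) - x₀ * (s * w.1.2 0)) ^ 2 + (y₀ * (s * w.1.1 1) - x₀ * (s * w.1.2 1)) ^ 2) /
        (450 * (L : ℝ) ^ 6 * ((1 + (x₀ ^ 2 + ((s * w.1.1 0) ^ 2 + (s * w.1.1 1) ^ 2))) * (1 + (y₀ ^ 2 + ((s * w.1.2 0) ^ 2 + (s * w.1.2 1) ^ 2))))) := by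
    rw [eq_div_iff (by positivity)]
    field_simp
    ring
  rw [e]
  exact h

end Minorants

/-! ## §3 The anisotropic fibre coercivity -/

/-- ★★★ **THE ANISOTROPIC FIBRE COERCIVITY AT EVERY GNOMONIC BASE POINT** (principal sector; hub `a ≠ 0`, signs `ε_z = +`, followers `+`; `A₀ = re a/‖a‖`,
`A₁ = ‖im a‖/‖a‖`, so `(2A₀A₁)² = sin²2ψ`, `A₁² = sin²ψ`): for EVERY fibre direction `w = ((u,v),z,η_F)`,
`(2/3)·[ ((2A₀A₁)²·4|u|²/(1+x₀²) + A₁²·4|v|²/(1+y₀²) + 4|z|²)/16200L⁶ + 2Σ_f|η_f|²/(2304L⁶|Fol L|) + |y₀u − x₀v|²/(450L⁶(1+x₀²)(1+y₀²)) ] ≤ (d²/ds²) F̂(η₀ + s·ξ(w))|₀`.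
[cite: Luscher1983, §2] -/
theorem fibre_raySecond_ge_aniso {a : ℍ} (ha : a ≠ 0) (ε : GnoSign L) (hz : ε.2.1 = true) (hε : ε.2.2 = fun _ => true) (x₀ y₀ : ℝ)
    (w : ((Fin 2 → ℝ) × (Fin 2 → ℝ)) × (Fin 3 → ℝ) × (Fol L → Fin 3 → ℝ)) :
    2 / 3 * (((2 * (‖a‖⁻¹ * a.re) * (‖a‖⁻¹ * ‖a.im‖)) ^ 2 * (4 * (w.1.1 0 ^ 2 + w.1.1 1 ^ 2) / (1 + x₀ ^ 2)) +
          (‖a‖⁻¹ * ‖a.im‖) ^ 2 * (4 * (w.1.2 0 ^ 2 + w.1.2 1 ^ 2) / (1 + y₀ ^ 2)) + 4 * normSq3 w.2.1) / (16200 * (L : ℝ) ^ 6) +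
        (∑ f, 2 * normSq3 (w.2.2 f)) / (2304 * (L : ℝ) ^ 6 * (Fintype.card (Fol L) : ℝ)) +
        ((y₀ * w.1.1 0 - x₀ * w.1.2 0) ^ 2 + (y₀ * w.1.1 1 - x₀ * w.1.2 1) ^ 2) / (450 * (L : ℝ) ^ 6 * ((1 + x₀ ^ 2) * (1 + y₀ ^ 2)))) ≤
      iteratedDeriv 2 (fun s : ℝ => gnoDeficit (fun _ => false) (fun _ => 1) a ε
        (((((![x₀, 0, 0] : Fin 3 → ℝ), (![y₀, 0, 0] : Fin 3 → ℝ)), ((0 : Fin 3 → ℝ), (0 : Fol L → Fin 3 → ℝ))) : GnoCoord L) +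
          s • ((((![0, w.1.1 0, w.1.1 1] : Fin 3 → ℝ), (![0, w.1.2 0, w.1.2 1] : Fin 3 → ℝ)), (w.2.1, w.2.2)) : GnoCoord L))) 0 := by
  have hL : (0 : ℝ) < L := by exact_mod_cast NeZero.pos L
  have hcard : 0 < (Fintype.card (Fol L) : ℝ) := by
    have h1 : 1 ≤ L := Nat.one_le_iff_ne_zero.2 (NeZero.ne L)
    have h4 : 1 ≤ L ^ 4 := Nat.one_le_pow _ _ h1
    have h : 0 < Fintype.card (Fol L) := by rw [card_fol]; omega
    exact_mod_cast h
  -- the three `h` functions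
  set h₁ : ℝ → ℝ := fun s => ((2 * (‖a‖⁻¹ * a.re) * (‖a‖⁻¹ * ‖a.im‖)) ^ 2 * (4 * (w.1.1 0 ^ 2 + w.1.1 1 ^ 2) / (1 + x₀ ^ 2 + s ^ 2 * (w.1.1 0 ^ 2 + w.1.1 1 ^ 2))) +
        (‖a‖⁻¹ * ‖a.im‖) ^ 2 * (4 * (w.1.2 0 ^ 2 + w.1.2 1 ^ 2) / (1 + y₀ ^ 2 + s ^ 2 * (w.1.2 0 ^ 2 + w.1.2 1 ^ 2))) +
        4 * normSq3 w.2.1 / (1 + s ^ 2 * normSq3 w.2.1)) / (16200 * (L : ℝ) ^ 6) with hh₁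
  set h₂ : ℝ → ℝ := fun s => (∑ f, 2 * normSq3 (w.2.2 f) / (1 + s ^ 2 * normSq3 (w.2.2 f))) / (2304 * (L : ℝ) ^ 6 * (Fintype.card (Fol L) : ℝ)) with hh₂
  set h₃ : ℝ → ℝ := fun s => ((y₀ * w.1.1 0 - x₀ * w.1.2 0) ^ 2 + (y₀ * w.1.1 1 - x₀ * w.1.2 1) ^ 2) /
        (450 * (L : ℝ) ^ 6 * ((1 + x₀ ^ 2 + s ^ 2 * (w.1.1 0 ^ 2 + w.1.1 1 ^ 2)) * (1 + y₀ ^ 2 + s ^ 2 * (w.1.2 0 ^ 2 + w.1.2 1 ^ 2)))) with hh₃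
  set φ : ℝ → ℝ := fun s : ℝ => gnoDeficit (fun _ => false) (fun _ => 1) a ε
        (((((![x₀, 0, 0] : Fin 3 → ℝ), (![y₀, 0, 0] : Fin 3 → ℝ)), ((0 : Fin 3 → ℝ), (0 : Fol L → Fin 3 → ℝ))) : GnoCoord L) +
          s • ((((![0, w.1.1 0, w.1.1 1] : Fin 3 → ℝ), (![0, w.1.2 0, w.1.2 1] : Fin 3 → ℝ)), (w.2.1, w.2.2)) : GnoCoord L)) with hφ
  -- smoothness
  have hz1 := normSq3_nonneg w.2.1
  have hq : ∀ (c e : ℝ), 0 < c → 0 ≤ e → ContDiff ℝ ∞ fun s : ℝ => c + s ^ 2 * e := by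
    intro c e _ _
    exact contDiff_const.add ((contDiff_id.pow 2).mul contDiff_const)
  have hqne : ∀ (c e : ℝ), 0 < c → 0 ≤ e → ∀ s : ℝ, c + s ^ 2 * e ≠ 0 := by
    intro c e hc he s
    positivity
  have hh₁d : ContDiff ℝ ∞ h₁ := by
    refine ContDiff.div_const ?_ _
    refine ((contDiff_const.mul (contDiff_const.div (hq _ _ (by positivity) (by positivity)) (hqne _ _ (by positivity) (by positivity)))).add
      (contDiff_const.mul (contDiff_const.div (hq _ _ (by positivity) (by positivity)) (hqne _ _ (by positivity) (by positivity))))).add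
      (contDiff_const.div (hq _ _ one_pos hz1) (hqne _ _ one_pos hz1))
  have hh₂d : ContDiff ℝ ∞ h₂ := by
    refine ContDiff.div_const ?_ _
    exact ContDiff.sum fun f _ => contDiff_const.div (hq _ _ one_pos (normSq3_nonneg _)) (hqne _ _ one_pos (normSq3_nonneg _))
  have hh₃d : ContDiff ℝ ∞ h₃ := by
    refine contDiff_const.div (contDiff_const.mul ((hq _ _ (by positivity) (by positivity)).mul (hq _ _ (by positivity) (by positivity)))) fun s => ?_
    positivity
  have hφd : ContDiff ℝ ∞ φ := contDiff_gnoDeficit_ray (L := L) (fun _ => false) (fun _ => 1) ha ε _ _ (n := ⊤)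
  -- touching at the base point
  have hφ0 : φ 0 = 0 := by
    simp only [hφ, zero_smul, add_zero]
    exact gnoDeficit_base_eq_zero ha ε hz hε x₀ y₀
  -- the three minorants
  have key := iteratedDeriv_two_ge_of_three_minorants (φ := φ) (γ₁ := fun s => s ^ 2 * h₁ s) (γ₂ := fun s => s ^ 2 * h₂ s) (γ₃ := fun s => s ^ 2 * h₃ s)
    hφd (contDiff_sq_mul hh₁d) (contDiff_sq_mul hh₂d) (contDiff_sq_mul hh₃d)
    (fun s => hub_ray_minorant (L := L) ε x₀ y₀ w ha s) (fun s => follower_ray_minorant (L := L) ε x₀ y₀ w a hε s)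
    (fun s => relRot_ray_minorant (L := L) ε x₀ y₀ w a s) (by simp [hφ0]) (by simp [hφ0]) (by simp [hφ0])
  have h2 : (2 : WithTop ℕ∞) ≤ ∞ := by norm_cast
  rw [iteratedDeriv_two_sq_mul (hh₁d.of_le h2), iteratedDeriv_two_sq_mul (hh₂d.of_le h2), iteratedDeriv_two_sq_mul (hh₃d.of_le h2)] at key
  -- evaluate the `h`'s at `0`
  have e1 : h₁ 0 = ((2 * (‖a‖⁻¹ * a.re) * (‖a‖⁻¹ * ‖a.im‖)) ^ 2 * (4 * (w.1.1 0 ^ 2 + w.1.1 1 ^ 2) / (1 + x₀ ^ 2)) +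
      (‖a‖⁻¹ * ‖a.im‖) ^ 2 * (4 * (w.1.2 0 ^ 2 + w.1.2 1 ^ 2) / (1 + y₀ ^ 2)) + 4 * normSq3 w.2.1) / (16200 * (L : ℝ) ^ 6) := by
    simp [hh₁]
  have e2 : h₂ 0 = (∑ f, 2 * normSq3 (w.2.2 f)) / (2304 * (L : ℝ) ^ 6 * (Fintype.card (Fol L) : ℝ)) := by simp [hh₂]
  have e3 : h₃ 0 = ((y₀ * w.1.1 0 - x₀ * w.1.2 0) ^ 2 + (y₀ * w.1.1 1 - x₀ * w.1.2 1) ^ 2) / (450 * (L : ℝ) ^ 6 * ((1 + x₀ ^ 2) * (1 + y₀ ^ 2))) := by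
    simp [hh₃]
  rw [e1, e2, e3] at key
  linarith

end Summit.QuantumFields.YangMills.Theorems.SwapVirialDeficit.BlowUpRing

end
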